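import Mathlib
import Summits.KontsevichZagierPeriods.Zeta5Search.DenomLaw.LawA4CoverKit
import Summits.KontsevichZagierPeriods.Zeta5Search.DenomLaw.LawA4Pal
import HarnessLib

/-!
# ζ(5) search — a COVER KIT for THEOREM A⁗′ (`SecondOrder.lawA4Pal`, `7 − 2M`): the five class clauses ((T3′): double raise OR palindrome) from a class-type cover — DENOM-LAW prover-d1 gen 20

HONEST FRAMING: systematic search; no irrationality claim unless certified.  Cell `pub-zeta5`, track «DENOM-LAW», seat `denom-prover-d1`
gen 20 (`HOME/denom-law/prover-d1/ATTEMPT-20.md`).  `p`-adic valuation bookkeeping for the explicit rationals `Cas_j(b)`; nothing about ζ(5);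
no model exponent moves; records in print UNMOVED.

WHY THIS FILE.  THEOREM A⁗′ (`DenomLaw/LawA4Pal.lean`, `SecondOrder.lawA4Pal`, prover-d1 gen 10: THEOREM A⁗ with (T3) weakened to (T3′) «every pole
class with `ν = −M + 2` is an admissible double raise of `T` OR A PALINDROME», value `7 − 2M`) has been in the tree since 2026-08-25 but was consumed only
per instance (`lawA4PalGuard`, `decide`) and was ABSENT from the ∀-`b` census of gen 18/19 (rungs LB … VGP): re-running that census with A⁗′ as a
type-level rung (prover-d1 g20, 0 port violations on 84,713 exact valuations) shows it is the largest missing rung — it reaches the node on 368 of the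
935 instances left open at `p ≤ 7` (the whole head configuration `(m, deep) = (−7, [−4,−4]ᶜ / [1,−5,−5,1]ᶜ)` of ATTEMPT-18 §3 (iii): frame `M = 8`,
deep layer empty, odd-centre class at `−7`, double raises and the conjugate pair of foreign palindromic singles `[0,−6,0]` at `−6`; open 1.71 % → 1.04 %;
p = 11 sample 1.96 % → 1.28 %).  For the general-`b` profile theorems the law is needed FROM A COVER, as gen 18's `DenomLaw/LawA4CoverKit` does for A⁗:
from a class-type cover of `b` (`ClassTypeCover.Cover`) and a SPELLED-OUT `List.all` check (no new definition) of the five clauses — H1–H4 of `LawA4`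
verbatim and (T3′) — the hypotheses of `lawA4Pal` (`lawA4PalHyps_of_cover`), and the any-`j` wrappers `lawA4Pal_of_cover` / `cover_A4P` (`M ≥ 6` even,
`T` a palindrome, window prime `5 ≤ p ≤ b₀ < p² − 2`).  Sanity `decide` on the census's head instance `b = (15;7,7,4,4,2,2,0)`, `p = 7`, frame
`(8, [−4,−4])`: the (T3′) check passes while `[0,−6,0]` is not a double raise of `[−4,−4]` (A⁗'s own (T3) fails there).
-/

open Finset

namespace Summit.KontsevichZagierPeriods.Zeta5Search.DenomLaw

open Summit.KontsevichZagierPeriods.Zeta5Search.ClusterValuation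
open Summit.KontsevichZagierPeriods.Zeta5Search.CasoratianValuation (InPolytope shift casoratian)
open Summit.KontsevichZagierPeriods.Zeta5Search.WedgeDictionary (dOf)
open Summit.KontsevichZagierPeriods.Zeta5Search.ClassTypeCover
open Summit.KontsevichZagierPeriods.Zeta5Search.SecondOrder (classTypeList isRaise isRaise2 lawA4Pal)

variable {p : ℕ}

/-- **The five A⁗′ clauses of `b` from a cover**: if every residue is a typed level class of a type in `TY` and, on the list (spelled-out `List.all`;
no new definition), every multipole type has `E ≥ −M`, singles `ν ≥ −M+1`, multipole types of exponent `−M` are centre-free with list `T`, pole types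
with `ν = −M+1` are single raises of `T` or the odd-centre type `T`, and pole types with `ν = −M+2` are admissible double raises of `T` OR PALINDROMES —
then H1–H4 of `LawA4` and (T3′) hold for `b` (the hypotheses of `SecondOrder.lawA4Pal`). -/
theorem lawA4PalHyps_of_cover [Fact p.Prime] {b : ℕ → ℤ} {TY : List (List ℤ × Bool)} (hcov : Cover b p TY) {M : ℕ} {T : List ℤ}
    (hchk : ((TY.all fun tc =>
      (decide (polesL tc.1 < 2) || decide (-(M : ℤ) ≤ expL (decide (¬ (2 : ℤ) ∣ b 0)) tc.1 tc.2)) &&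
      (!decide (polesL tc.1 = 1) || decide (-(M : ℤ) + 1 ≤ nuL (decide (¬ (2 : ℤ) ∣ b 0)) tc.1 tc.2)) &&
      (!(decide (2 ≤ polesL tc.1) && decide (expL (decide (¬ (2 : ℤ) ∣ b 0)) tc.1 tc.2 = -(M : ℤ))) || (!tc.2 && decide (tc.1 = T))) &&
      (!(decide (1 ≤ polesL tc.1) && decide (nuL (decide (¬ (2 : ℤ) ∣ b 0)) tc.1 tc.2 = -(M : ℤ) + 1)) ||
        (isRaise T tc.1 || (decide (¬ (2 : ℤ) ∣ b 0) && tc.2 && decide (tc.1 = T)))) &&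
      (!(decide (1 ≤ polesL tc.1) && decide (nuL (decide (¬ (2 : ℤ) ∣ b 0)) tc.1 tc.2 = -(M : ℤ) + 2)) ||
        (isRaise2 T tc.1 || decide (tc.1.reverse = tc.1)))) = true)) :
    (∀ x ∈ multipoleClasses b p, -(M : ℤ) ≤ classExp b p x) ∧
    (∀ y, y < p → classPoleCount b p y = 1 → -(M : ℤ) + 1 ≤ classNu b p y) ∧
    (∀ x ∈ multipoleClasses b p, classExp b p x = -(M : ℤ) → ¬ CentreIn b p x ∧ classTypeList b p x = T) ∧
    (∀ y, y < p → 1 ≤ classPoleCount b p y → classNu b p y = -(M : ℤ) + 1 →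
      isRaise T (classTypeList b p y) = true ∨ (¬ (2 : ℤ) ∣ b 0 ∧ CentreIn b p y ∧ classTypeList b p y = T)) ∧
    (∀ z, z < p → 1 ≤ classPoleCount b p z → classNu b p z = -(M : ℤ) + 2 →
      isRaise2 T (classTypeList b p z) = true ∨ (classTypeList b p z).reverse = classTypeList b p z) := by
  rw [List.all_eq_true] at hchk
  refine ⟨?_, ?_, ?_, ?_, ?_⟩
  · intro x hxm
    obtain ⟨hx, h2⟩ := (mem_multipoleClasses_iff b p x).1 hxm
    obtain ⟨tc, htc, ht⟩ := hcov x hx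
    have hc := hchk tc htc
    simp only [Bool.and_eq_true, Bool.or_eq_true, decide_eq_true_eq] at hc
    rw [ht.classPoleCount_eq] at h2
    rw [ht.classExp_eq]
    rcases hc.1.1.1.1 with h | h
    · omega
    · exact h
  · intro y hy h1
    obtain ⟨tc, htc, ht⟩ := hcov y hy
    have hc := hchk tc htc
    simp only [Bool.and_eq_true, Bool.or_eq_true, Bool.not_eq_true', decide_eq_false_iff_not, decide_eq_true_eq] at hc
    rw [ht.classPoleCount_eq] at h1
    rw [ht.classNu_eq]
    rcases hc.1.1.1.2 with h | h
    · exact absurd h1 h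
    · exact h
  · intro x hxm hE
    obtain ⟨hx, h2⟩ := (mem_multipoleClasses_iff b p x).1 hxm
    obtain ⟨tc, htc, ht⟩ := hcov x hx
    have hc := hchk tc htc
    simp only [Bool.and_eq_true, Bool.or_eq_true, Bool.not_eq_true', Bool.and_eq_false_iff, decide_eq_false_iff_not,
      decide_eq_true_eq] at hc
    rw [ht.classPoleCount_eq] at h2
    rw [ht.classExp_eq] at hE
    rcases hc.1.1.2 with (h | h) | ⟨hc1, hc2⟩
    · omega
    · exact absurd hE h
    · refine ⟨fun hcen => ?_, by rw [ht.classTypeList_eq]; exact hc2⟩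
      rw [ht.cen_iff.1 hcen] at hc1
      exact Bool.noConfusion hc1
  · intro y hy h1 hnu
    obtain ⟨tc, htc, ht⟩ := hcov y hy
    have hc := hchk tc htc
    simp only [Bool.and_eq_true, Bool.or_eq_true, Bool.not_eq_true', Bool.and_eq_false_iff, decide_eq_false_iff_not,
      decide_eq_true_eq] at hc
    rw [ht.classPoleCount_eq] at h1
    rw [ht.classNu_eq] at hnu
    rcases hc.1.2 with (h | h) | (h | ⟨⟨ho, hc1⟩, hc2⟩)
    · omega
    · exact absurd hnu h
    · left; rw [ht.classTypeList_eq]; exact h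
    · right
      exact ⟨ho, ht.cen_iff.2 hc1, by rw [ht.classTypeList_eq]; exact hc2⟩
  · intro z hz h1 hnu
    obtain ⟨tc, htc, ht⟩ := hcov z hz
    have hc := hchk tc htc
    simp only [Bool.and_eq_true, Bool.or_eq_true, Bool.not_eq_true', Bool.and_eq_false_iff, decide_eq_false_iff_not,
      decide_eq_true_eq] at hc
    rw [ht.classPoleCount_eq] at h1
    rw [ht.classNu_eq] at hnu
    rcases hc.2 with (h | h) | (h | h)
    · omega
    · exact absurd hnu h
    · left; rw [ht.classTypeList_eq]; exact h
    · right; rw [ht.classTypeList_eq]; exact h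

/-- **THEOREM A⁗′ from a cover of `b` alone**: `7 − 2M ≤ v_p(Cas_j(b))` (`M ≥ 6` even, `T` a palindrome, `5 ≤ p ≤ b₀ < p² − 2`, any admissible `j`). -/
theorem lawA4Pal_of_cover {b : ℕ → ℤ} {j : ℕ} (hb : InPolytope b) (hb' : InPolytope (shift b j)) (hj1 : 1 ≤ j) (hj7 : j ≤ 7)
    (hpr : p.Prime) (hp5 : 5 ≤ p) (hpb : (p : ℤ) ≤ b 0) (hwin : (b 0 + 2 : ℤ) < (p : ℤ) ^ 2)
    {TY : List (List ℤ × Bool)} (hcov : Cover b p TY) {M : ℕ} (hM : 6 ≤ M) (hMe : Even M) {T : List ℤ} (hT : T.reverse = T)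
    (hchk : ((TY.all fun tc =>
      (decide (polesL tc.1 < 2) || decide (-(M : ℤ) ≤ expL (decide (¬ (2 : ℤ) ∣ b 0)) tc.1 tc.2)) &&
      (!decide (polesL tc.1 = 1) || decide (-(M : ℤ) + 1 ≤ nuL (decide (¬ (2 : ℤ) ∣ b 0)) tc.1 tc.2)) &&
      (!(decide (2 ≤ polesL tc.1) && decide (expL (decide (¬ (2 : ℤ) ∣ b 0)) tc.1 tc.2 = -(M : ℤ))) || (!tc.2 && decide (tc.1 = T))) &&
      (!(decide (1 ≤ polesL tc.1) && decide (nuL (decide (¬ (2 : ℤ) ∣ b 0)) tc.1 tc.2 = -(M : ℤ) + 1)) ||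
        (isRaise T tc.1 || (decide (¬ (2 : ℤ) ∣ b 0) && tc.2 && decide (tc.1 = T)))) &&
      (!(decide (1 ≤ polesL tc.1) && decide (nuL (decide (¬ (2 : ℤ) ∣ b 0)) tc.1 tc.2 = -(M : ℤ) + 2)) ||
        (isRaise2 T tc.1 || decide (tc.1.reverse = tc.1)))) = true)) (hcas : casoratian b j ≠ 0) :
    (7 : ℤ) - 2 * M ≤ padicValRat p (casoratian b j) := by
  haveI : Fact p.Prime := ⟨hpr⟩
  obtain ⟨H1, H2, H3, H4, H5⟩ := lawA4PalHyps_of_cover hcov hchk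
  exact lawA4Pal b j M T hb hb' ⟨hj1, hj7⟩ hp5 hpb hwin ⟨hM, hMe⟩ hT H1 H2 H3 H4 H5 hcas

/-- **WINDOW BOUND by THEOREM A⁗′ from a cover**: `c ≤ v_p(Cas_j(b))` whenever `c ≤ 7 − 2M`. -/
theorem cover_A4P {b : ℕ → ℤ} {j : ℕ} (hb : InPolytope b) (hb' : InPolytope (shift b j)) (hj1 : 1 ≤ j) (hj7 : j ≤ 7)
    (hpr : p.Prime) (hp5 : 5 ≤ p) (hpb : (p : ℤ) ≤ b 0) (hwin : (b 0 + 2 : ℤ) < (p : ℤ) ^ 2)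
    {TY : List (List ℤ × Bool)} (hcov : Cover b p TY) {M : ℕ} (hM : 6 ≤ M) (hMe : Even M) {T : List ℤ} (hT : T.reverse = T)
    (hchk : ((TY.all fun tc =>
      (decide (polesL tc.1 < 2) || decide (-(M : ℤ) ≤ expL (decide (¬ (2 : ℤ) ∣ b 0)) tc.1 tc.2)) &&
      (!decide (polesL tc.1 = 1) || decide (-(M : ℤ) + 1 ≤ nuL (decide (¬ (2 : ℤ) ∣ b 0)) tc.1 tc.2)) &&
      (!(decide (2 ≤ polesL tc.1) && decide (expL (decide (¬ (2 : ℤ) ∣ b 0)) tc.1 tc.2 = -(M : ℤ))) || (!tc.2 && decide (tc.1 = T))) &&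
      (!(decide (1 ≤ polesL tc.1) && decide (nuL (decide (¬ (2 : ℤ) ∣ b 0)) tc.1 tc.2 = -(M : ℤ) + 1)) ||
        (isRaise T tc.1 || (decide (¬ (2 : ℤ) ∣ b 0) && tc.2 && decide (tc.1 = T)))) &&
      (!(decide (1 ≤ polesL tc.1) && decide (nuL (decide (¬ (2 : ℤ) ∣ b 0)) tc.1 tc.2 = -(M : ℤ) + 2)) ||
        (isRaise2 T tc.1 || decide (tc.1.reverse = tc.1)))) = true)) {c : ℤ} (hc : c ≤ 7 - 2 * (M : ℤ)) (hcas : casoratian b j ≠ 0) :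
    c ≤ padicValRat p (casoratian b j) :=
  le_trans hc (lawA4Pal_of_cover hb hb' hj1 hj7 hpr hp5 hpb hwin hcov hM hMe hT hchk hcas)

/-- Sanity of the spelled-out check on the census's head instance `b = (15;7,7,4,4,2,2,0)`, `p = 7` (class types `[0,−6,0]`, `[−2,−4]`, `[−4,−4]ᶜ`,
`[−4,−2]`; `b₀` odd), frame `(8, [−4,−4])`: the (T3′) check passes, and the foreign single `[0,−6,0]` at `ν = −6` is NOT an admissible double raise of
`[−4,−4]` (so THEOREM A⁗'s own clause (T3) fails there). -/
example : (([([0, -6, 0], false), ([-2, -4], false), ([-4, -4], true), ([-4, -2], false)] : List (List ℤ × Bool)).all fun tc =>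
      (decide (polesL tc.1 < 2) || decide (-((8 : ℕ) : ℤ) ≤ expL true tc.1 tc.2)) &&
      (!decide (polesL tc.1 = 1) || decide (-((8 : ℕ) : ℤ) + 1 ≤ nuL true tc.1 tc.2)) &&
      (!(decide (2 ≤ polesL tc.1) && decide (expL true tc.1 tc.2 = -((8 : ℕ) : ℤ))) || (!tc.2 && decide (tc.1 = [-4, -4]))) &&
      (!(decide (1 ≤ polesL tc.1) && decide (nuL true tc.1 tc.2 = -((8 : ℕ) : ℤ) + 1)) ||
        (isRaise [-4, -4] tc.1 || (true && tc.2 && decide (tc.1 = [-4, -4])))) &&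
      (!(decide (1 ≤ polesL tc.1) && decide (nuL true tc.1 tc.2 = -((8 : ℕ) : ℤ) + 2)) ||
        (isRaise2 [-4, -4] tc.1 || decide (tc.1.reverse = tc.1)))) = true ∧
    isRaise2 [-4, -4] [0, -6, 0] = false := by decide

end Summit.KontsevichZagierPeriods.Zeta5Search.DenomLaw
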